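import Summits.ValiantsHypothesis.ValiantsHypothesis.Theorems.SymPencilOriginMoments
import Summits.ValiantsHypothesis.ValiantsHypothesis.Theorems.SymPencilLagrangianKernel

/-!
# Route `SymPencil` — the moments of a symmetric pencil at a BASE POINT of the kernel variety
# (tool file for the one-row cell `(12,4,0)` / `(12,4,1)` of `sdc(per_4)`, `--supports`
# stmt-ValiantsHypothesis-5674; nothing here bears on `VP ≠ VNP`)

Pure matrix algebra, the twin of `SymPencilOriginMoments.moments_four` one order lower.  Let `N` be
invertible, `C₀` any square matrix, `a₀, φ, ψ` scalars and `b₀` a vector, and suppose that for every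
scalar `s`

  `det [[s a₀, s b₀ᵀ], [s b₀, N + s C₀]] = s³ φ + s⁴ ψ`.                                  (E₃)

Then (`moments_three`) `a₀ = 0`, `b₀ᵀ N⁻¹ b₀ = 0` and `det N · b₀ᵀ N⁻¹ C₀ N⁻¹ b₀ = φ`.

This is the shape of the pencil identity of a symmetric affine determinantal representation
`A₀ + M(z)` of `per_4` read not at the origin but at a point `v` of the kernel space `V = ker b`
(where `A(v) = A₀ + M(v)` still has the kernel vector `w₀` and `Pᵀ A(v) P = 0 ⊕ (D + C(v))`):
`det (A(v) + s M(z)) = κ per_4 (v + s z) = κ (s³ per_4(v; z) + s⁴ per_4 z)` when `v` is a one-row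
matrix, so `N = D + C(v)` and `φ = κ · per_4(v; z)` — the CUBIC moment that vanishes at the origin
is alive at the base point.  If moreover `b₀ = N u` (`basepoint_moment`), the conclusion reads
`det N · uᵀ C₀ u = φ`: the block `C₀` is seen only through the vector `u = N⁻¹ b₀`, which for the
one-row cell stays in the Lagrangian `D⁻¹ (im b)` — this is what makes val-width-5676-p2 g4's
"pure-ansatz" identity `((1+K(v))⁻¹ r)ᵀ S(r) ((1+K(v))⁻¹ r) = κ per_4(v; r)` hold for EVERY
symmetric representation with a one-row kernel (the blocks `C₁₁`, `C₁₂(r)` drop out).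
Elementary. [folklore]
-/

noncomputable section

-- single-conjunct layout: Sub = Summit, duplicated namespace component intended
set_option linter.dupNamespace false

namespace Summit.ValiantsHypothesis.ValiantsHypothesis.Theorems.SymPencilBasePointMoments

open Matrix Polynomial
open Summit.ValiantsHypothesis.ValiantsHypothesis.Theorems.SymPencilHomogeneousDropTools
open Summit.ValiantsHypothesis.ValiantsHypothesis.Theorems.SymPencilAdjugateExpansion
open Summit.ValiantsHypothesis.ValiantsHypothesis.Theorems.SymPencilOriginMoments
open Summit.ValiantsHypothesis.ValiantsHypothesis.Theorems.SymPencilLagrangianKernel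

universe u

variable {k : Type u} [Field k] [CharZero k] {ι' : Type*} [Fintype ι'] [DecidableEq ι']

/-- **The moments of a symmetric pencil at a base point, cubic order.**  If
`det [[s a₀, s b₀ᵀ], [s b₀, N + s C₀]] = s³ φ + s⁴ ψ` for all `s`, with `N` invertible, then
`a₀ = 0`, `b₀ᵀ N⁻¹ b₀ = 0` and `det N · b₀ᵀ N⁻¹ C₀ N⁻¹ b₀ = φ`. [folklore] -/
theorem moments_three {N C₀ : Matrix ι' ι' k} (hN : IsUnit N.det) (a₀ φ ψ : k) (b₀ : ι' → k)
    (hE : ∀ s : k, (Matrix.fromBlocks ((s * a₀) • (1 : Matrix Unit Unit k))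
        (Matrix.replicateRow Unit (s • b₀)) (Matrix.replicateCol Unit (s • b₀)) (N + s • C₀)).det =
        s ^ 3 * φ + s ^ 4 * ψ) :
    a₀ = 0 ∧ b₀ ⬝ᵥ N⁻¹ *ᵥ b₀ = 0 ∧ N.det * (b₀ ⬝ᵥ (N⁻¹ * C₀ * N⁻¹) *ᵥ b₀) = φ := by
  classical
  have hN0 : N.det ≠ 0 := hN.ne_zero
  -- the two polynomials in play
  set δ : k[X] := (N.map Polynomial.C + (Polynomial.X : k[X]) • C₀.map Polynomial.C).det with hδ
  set g : k[X] := (fun i => Polynomial.C (b₀ i)) ⬝ᵥ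
      adjugate (N.map Polynomial.C + (Polynomial.X : k[X]) • C₀.map Polynomial.C) *ᵥ
      (fun i => Polynomial.C (b₀ i)) with hg
  set Q : k[X] := Polynomial.C a₀ * (Polynomial.X ^ 1 * δ) - Polynomial.X ^ 2 * g -
      Polynomial.C φ * Polynomial.X ^ 3 - Polynomial.C ψ * Polynomial.X ^ 4 with hQ
  -- `Q` vanishes wherever `det (N + s C₀) ≠ 0`
  have hroot : ∀ s : k, (N + s • C₀).det ≠ 0 → Q.IsRoot s := by
    intro s hs
    have hSu : IsUnit (N + s • C₀).det := isUnit_iff_ne_zero.2 hs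
    have h1 := hE s
    rw [det_fromBlocks_border hSu, Matrix.mulVec_smul, dotProduct_smul, smul_dotProduct,
      smul_eq_mul, smul_eq_mul] at h1
    have hadj : b₀ ⬝ᵥ adjugate (N + s • C₀) *ᵥ b₀ =
        (N + s • C₀).det * (b₀ ⬝ᵥ (N + s • C₀)⁻¹ *ᵥ b₀) := by
      have : adjugate (N + s • C₀) = (N + s • C₀).det • (N + s • C₀)⁻¹ := by
        rw [Matrix.nonsing_inv_apply _ hSu, smul_smul, IsUnit.mul_val_inv, one_smul]
      rw [this, Matrix.smul_mulVec, dotProduct_smul, smul_eq_mul]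
    rw [Polynomial.IsRoot.def, hQ]
    simp only [Polynomial.eval_sub, Polynomial.eval_mul, Polynomial.eval_C, Polynomial.eval_X,
      Polynomial.eval_pow]
    rw [hδ, eval_detLine, hg, eval_bilin_adjugate_line, hadj]
    linear_combination h1
  -- hence `Q = 0`
  have hQ0 : Q = 0 := by
    apply Polynomial.eq_zero_of_infinite_isRoot
    have hδ0 : δ ≠ 0 := by
      intro h
      have h0 := coeff_detLine_zero N C₀
      rw [← hδ, h, Polynomial.coeff_zero] at h0
      exact hN0 h0.symm
    have hfin : Set.Finite {s : k | δ.IsRoot s} := (δ.roots.toFinset.finite_toSet).subset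
      fun s hs => by
        simp only [Set.mem_setOf_eq] at hs
        simp only [Finset.mem_coe, Multiset.mem_toFinset, Polynomial.mem_roots hδ0]
        exact hs
    refine (hfin.infinite_compl).mono fun s hs => ?_
    simp only [Set.mem_compl_iff, Set.mem_setOf_eq, Polynomial.IsRoot.def, hδ, eval_detLine] at hs
    exact hroot s hs
  -- the coefficients of `g`
  obtain ⟨d₁, d₂, hg0, hg1, -⟩ := coeff_bilin_adjugate_line hN C₀ b₀ b₀
  rw [← hg] at hg0 hg1
  have hδc0 : δ.coeff 0 = N.det := by rw [hδ, coeff_detLine_zero]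
  -- read off the coefficients of `Q`
  have hc : ∀ n, Q.coeff n = 0 := fun n => by rw [hQ0, Polynomial.coeff_zero]
  have hQn : ∀ n, Q.coeff n = a₀ * (if 1 ≤ n then δ.coeff (n - 1) else 0) -
      (if 2 ≤ n then g.coeff (n - 2) else 0) - (if n = 3 then φ else 0) -
      (if n = 4 then ψ else 0) := by
    intro n
    rw [hQ, Polynomial.coeff_sub, Polynomial.coeff_sub, Polynomial.coeff_sub,
      Polynomial.coeff_C_mul, Polynomial.coeff_X_pow_mul', Polynomial.coeff_X_pow_mul',
      Polynomial.coeff_C_mul_X_pow, Polynomial.coeff_C_mul_X_pow]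
  have e1 := hQn 1
  have e2 := hQn 2
  have e3 := hQn 3
  norm_num at e1 e2 e3
  rw [hc] at e1 e2 e3
  rw [hδc0] at e1
  have h1 : a₀ = 0 := by
    rcases mul_eq_zero.1 e1.symm with h | h
    · exact h
    · exact absurd h hN0
  rw [h1, zero_mul, zero_sub] at e2 e3
  rw [hg0] at e2
  have h2 : b₀ ⬝ᵥ N⁻¹ *ᵥ b₀ = 0 := by
    rcases mul_eq_zero.1 (neg_eq_zero.1 e2.symm) with h | h
    · exact absurd h hN0
    · exact h
  rw [hg1, h2, mul_zero, zero_sub] at e3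
  have h3 : N.det * (b₀ ⬝ᵥ (N⁻¹ * C₀ * N⁻¹) *ᵥ b₀) = φ := by
    linear_combination -e3
  exact ⟨h1, h2, h3⟩

/-- **The base-point moment for a kernel-row vector of the form `b₀ = N u`.**  If
`det [[s a₀, s (N u)ᵀ], [s N u, N + s C₀]] = s³ φ + s⁴ ψ` for all `s`, with `N` invertible and
symmetric, then `det N · uᵀ C₀ u = φ` (and `a₀ = 0`, `uᵀ N u = 0`).  The point: `C₀` enters only
through `uᵀ C₀ u`. [folklore] -/
theorem basepoint_moment {N C₀ : Matrix ι' ι' k} (hN : IsUnit N.det) (hNs : Nᵀ = N) (a₀ φ ψ : k)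
    (u : ι' → k)
    (hE : ∀ s : k, (Matrix.fromBlocks ((s * a₀) • (1 : Matrix Unit Unit k))
        (Matrix.replicateRow Unit (s • N *ᵥ u)) (Matrix.replicateCol Unit (s • N *ᵥ u))
        (N + s • C₀)).det = s ^ 3 * φ + s ^ 4 * ψ) :
    a₀ = 0 ∧ u ⬝ᵥ N *ᵥ u = 0 ∧ N.det * (u ⬝ᵥ C₀ *ᵥ u) = φ := by
  obtain ⟨h1, h2, h3⟩ := moments_three hN a₀ φ ψ (N *ᵥ u) hE
  have hNis : (N⁻¹)ᵀ = N⁻¹ := by rw [Matrix.transpose_nonsing_inv, hNs]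
  have hNu : N⁻¹ *ᵥ (N *ᵥ u) = u := by
    rw [Matrix.mulVec_mulVec, Matrix.nonsing_inv_mul _ hN, Matrix.one_mulVec]
  have hq : (N *ᵥ u) ⬝ᵥ N⁻¹ *ᵥ (N *ᵥ u) = u ⬝ᵥ N *ᵥ u := by
    rw [hNu, dotProduct_comm, dotProduct_mulVec_of_transpose_eq hNs]
  have hs : (N *ᵥ u) ⬝ᵥ (N⁻¹ * C₀ * N⁻¹) *ᵥ (N *ᵥ u) = u ⬝ᵥ C₀ *ᵥ u := by
    rw [sandwich₂_eq hNis, hNu]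
  refine ⟨h1, by rwa [hq] at h2, by rwa [hs] at h3⟩

end Summit.ValiantsHypothesis.ValiantsHypothesis.Theorems.SymPencilBasePointMoments

end
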